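import Literature.IUT.HodgeArakelov.EtaleThetaDataOfSettingRootHypOfCor28i

/-!
# GAP row G-w5d169-2, ROUTE 2 — v2: `Dtau`-stability only UP TO AN INNER AUTOMORPHISM from `Π^tp_{X̲̲}`
# (FINDING F-w5d118g5-1 on the v1 binder `hDtau`)

S. Mochizuki, *The étale theta function …*, Publ. RIMS **45** (2009) [EtTh] (refereed): Prop 2.4 p. 38, Cor 2.8 (i) p. 42
(«`γ` … preserves the property that `η̲̈^{Θ,l·ℤ×μ₂}` be of standard type»; the proof of Thm 1.10, pp. 29–30: «`γ` maps [the
decomposition groups over] `τ` to [those over] `τ^{±1}`»), Thm 1.6 (iii) p. 24.  [claim: Mochizuki2012, status: disputed]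
(IUTchII §1 Prop 1.4, kurims p.27) for the consumer `hroot`.

abc-iut cell, seat abc-iut-w5-d118 (gen 5); GAP-LEDGER G-w5d169-2 ROUTE 2 (abc-iut-L2-lead R250/R319).  PROOF-ONLY sequel
(no definition, no new `Prop` fact) of `EtaleThetaDataOfSettingRootHypOfCor28i` (p443943).  FINDING F-w5d118g5-1: the named
fact F-0640 `ThetaOrbitData.Cor28_i` conditions its conclusions on EXACT set-stability of the two chosen decomposition groups
`Dtau`; inner automorphisms of `Π^tp_C` by elements of `ι(Π^tp_{X̲̲})` stabilise the whole Prop 2.4 tower of `T`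
(`map_innerAutTop_tower_of_mem_Huu`) but move those groups, so v1's binder `hDtau` («EVERY tower-stabilising `Γ` permutes
`Dtau`») is stronger than print and, at genuine data, not satisfiable as quantified.  v2 asks only that the Prop 2.4
extension of each `α` becomes `Dtau`-stabilising AFTER an inner adjustment `γ_{ι u}`, `u ∈ Π^tp_{X̲̲}` — and shows the
conclusion does not see the adjustment:
* `map_innerAutTop_eq_of_mem`, `map_innerAutTop_PiYddtp`, `map_innerAutTop_tower_of_mem_Huu`;
* `transport_of_inner_trans` — [EtTh] Thm 1.6's transport along `conj_u ∘ γ` is `conj_u ∘` (transport along `γ`) for ANY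
  theta companions (their theta isomorphisms differ by `conj_{u^Θ}`, by surjectivity of `(·)^Θ`);
* **`extends_transport_eq_conj_of_cor28_i_innerAdjust`** (the `hE`-body of p436936 per `α`) and
  **`rootHyp_of_cor28_i_innerAdjust`** (= `hroot`), with `hDtau` replaced by
  `∀ Γ, tower-stable Γ → ∃ u ∈ C.Huu, Dtau is (Γ ≫ γ_{ι u})-stable`, via v1's chain at the adjusted pair and
  `ContH1.comap_conj` / `conj_mul_apply` / `conj_inv_conj_apply`.
RESIDUAL BINDERS (BY NAME / print-shaped): F-0609 `Prop24`, F-0640 `Cor28_i`@`ofEmbedding`, `IsStandard`, the inner-adjusted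
`Dtau` clause, `hΔ` ([AbsAnab] Lem 1.3.8 shape), `hq`, `hιe`/`hιX`.  Nothing of [IUTchII] asserted; no side taken on
[IUTchIII] Cor. 3.12; typed ≠ proved; a finding about OUR typed interface, not about print.
-/

noncomputable section

open Topology

namespace Literature.IUT.HodgeArakelov

namespace EtaleThetaDataOfSetting

open Literature.AnabelianGeometry.EtaleTheta Literature.AnabelianGeometry.SemiGraphs ThetaCovers
open Literature.AnabelianGeometry.EtaleTheta CohomologySystemOfContH1

universe u

variable {p : ℕ} [Fact p.Prime] {D : Literature.AnabelianGeometry.EtaleTheta.ThetaSetting p}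
  {E : D.EtaleThetaData} {l : ℕ} (C : E.DoubleUnderline l) {T : TemperedCoverData.{u} l}
  (ε : C.OrbitEmbedding T)

/-! ### v2 (FINDING F-w5d118g5-1): `Dtau`-stability UP TO AN INNER AUTOMORPHISM FROM `Π^tp_{X̲̲}`

The named fact F-0640 conditions its conclusions on EXACT stability of the two chosen decomposition groups `Dtau`; inner
automorphisms of `Π^tp_C` by elements of `ι(Π^tp_{X̲̲})` stabilise the whole Prop 2.4 tower (`map_innerAutTop_tower_of_mem_Huu`)
but move those groups, so the v1 binder `hDtau` (stability for EVERY tower-stabilising `Γ`) is too strong.  v2 asks only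
that the Prop 2.4 extension `Γ` of each `α` can be ADJUSTED by an inner automorphism `γ_{ι u}`, `u ∈ Π^tp_{X̲̲}`, into a
`Dtau`-stabilising one («`γ` maps `τ` to `τ^{±1}`» after choosing the lift) — the conclusion, a `Π^tp_{X̲̲}`-conjugacy
statement, is insensitive to the adjustment (`transport_of_inner_trans` + `ContH1.comap_conj`). -/

section InnerAdjust

variable {C}

/-- An inner automorphism of `Π^tp_C` by an element of `S` stabilises `S`. [cite: MochizukiEtTh2009, Prop 2.4 p.38] -/
theorem map_innerAutTop_eq_of_mem (S : Subgroup T.Gtp) {x : T.Gtp} (hx : x ∈ S) :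
    S.map (ThetaOrbitData.innerAutTop x).toMulEquiv.toMonoidHom = S := by
  ext y
  constructor
  · rintro ⟨t, ht, rfl⟩
    exact S.mul_mem (S.mul_mem hx ht) (S.inv_mem hx)
  · intro hy
    refine ⟨x⁻¹ * y * x, S.mul_mem (S.mul_mem (S.inv_mem hx) hy) hx, ?_⟩
    show x * (x⁻¹ * y * x) * x⁻¹ = y
    group

/-- `γ_{ι u}` stabilises `Π^tp_Ÿ` of `T` (`= ι(Π^tp_Ÿ)`, normal in `Π^tp_X`). [cite: MochizukiEtTh2009, Def 2.7 p.41] -/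
theorem map_innerAutTop_PiYddtp [D.GtpYdd.Normal] (u : D.PiTemp) :
    T.PiYddtp.map (ThetaOrbitData.innerAutTop (ε.ι u)).toMulEquiv.toMonoidHom = T.PiYddtp := by
  ext y
  constructor
  · rintro ⟨t, ht, rfl⟩
    exact ε.conj_mem_PiYddtp u ⟨t, ht⟩
  · intro hy
    refine ⟨(ε.ι u)⁻¹ * y * ε.ι u, ε.inv_conj_mem_PiYddtp u ⟨y, hy⟩, ?_⟩
    show ε.ι u * ((ε.ι u)⁻¹ * y * ε.ι u) * (ε.ι u)⁻¹ = y
    group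

/-- **Inner automorphisms by `ι(Π^tp_{X̲̲})` stabilise the whole Prop 2.4 tower of `T`** (`ι u` lies in every member but
`Π^tp_Ÿ`, which `ι(Π^tp_X)` normalises). [cite: MochizukiEtTh2009, Prop 2.4 p.38] -/
theorem map_innerAutTop_tower_of_mem_Huu [D.GtpYdd.Normal] {u : D.PiTemp} (hu : u ∈ C.Huu) :
    ∀ S ∈ T.tower, S.map (ThetaOrbitData.innerAutTop (ε.ι u)).toMulEquiv.toMonoidHom = S := by
  have hx : ε.ι u ∈ T.tp T.PiXuu := ε.map_Huu.le ⟨u, hu, rfl⟩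
  have hx' : T.toHat (ε.ι u) ∈ T.PiXuu := hx
  have hU : T.toHat (ε.ι u) ∈ T.PiCuu := (Subgroup.mem_inf.mp hx').1
  have hX : T.toHat (ε.ι u) ∈ T.PiX := (Subgroup.mem_inf.mp hx').2
  intro S hS
  simp only [TemperedCoverData.tower, List.mem_cons, List.not_mem_nil, or_false] at hS
  rcases hS with rfl | rfl | rfl | rfl | rfl | rfl
  · exact map_innerAutTop_eq_of_mem _ hx
  · exact map_innerAutTop_eq_of_mem _ (show T.toHat (ε.ι u) ∈ T.PiXu from Subgroup.mem_sup_left hx')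
  · exact map_innerAutTop_eq_of_mem _ (show T.toHat (ε.ι u) ∈ T.PiX from hX)
  · exact map_innerAutTop_eq_of_mem _ (show T.toHat (ε.ι u) ∈ T.PiCuu from hU)
  · exact map_innerAutTop_eq_of_mem _ (show T.toHat (ε.ι u) ∈ T.PiCu from Subgroup.mem_sup_left hU)
  · exact map_innerAutTop_PiYddtp ε u

/-- **Thm 1.6's transport along an INNER modification `γ' = conj_u ∘ γ` is `conj_u ∘ transport`**: for companions `c` of
`γ` and `c'` of `γ'` (`γ' z = u·γ(z)·u⁻¹`), `transport c' h' x = conj_u (transport c h x)` on `H¹(Π^tp_Ÿ, Δ_Θ)` (the companions'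
theta isomorphisms differ by `conj_{u^Θ}`, by surjectivity of `(·)^Θ`). [cite: MochizukiEtTh2009, Thm 1.6 (iii) p.24] -/
theorem transport_of_inner_trans [D.GtpYdd.Normal] {γ γ' : D.PiTemp ≃ₜ* D.PiTemp} (u : D.PiTemp)
    (hγ' : ∀ z, γ' z = u * γ z * u⁻¹) (h : ThetaSetting.Thm16i γ) (h' : ThetaSetting.Thm16i γ')
    (c : ThetaSetting.ThetaCompanion γ) (c' : ThetaSetting.ThetaCompanion γ') (x : D.H1 D.GtpYdd) :
    ThetaSetting.transport c' h' x = ContH1.conj D.toTheta D.DeltaTheta u (ThetaSetting.transport c h x) := by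
  -- the theta isomorphisms differ by conjugation by `u^Θ`
  have hθ : ∀ t : D.GtpTheta, c'.thetaIso t = D.toTheta u * c.thetaIso t * (D.toTheta u)⁻¹ := by
    intro t
    obtain ⟨z, rfl⟩ := D.toTheta_surjective t
    have h1 : c'.thetaIso (D.toTheta z) = D.toTheta (γ' z) := (c'.comm z).symm
    have h2 : c.thetaIso (D.toTheta z) = D.toTheta (γ z) := (c.comm z).symm
    rw [h1, h2, hγ', map_mul, map_mul, map_inv]
  -- `γ'⁻¹ y = γ⁻¹ (u⁻¹ y u)`
  have hinv : ∀ y : D.PiTemp, γ'.symm y = γ.symm (u⁻¹ * y * u) := by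
    intro y
    apply γ'.injective
    rw [ContinuousMulEquiv.apply_symm_apply, hγ', ContinuousMulEquiv.apply_symm_apply]
    group
  induction x using QuotientGroup.induction_on with
  | H f =>
    change QuotientGroup.mk (ThetaSetting.transportCocycle c' h' f) =
      QuotientGroup.mk (ContH1.conjCocycle D.toTheta D.DeltaTheta u (ThetaSetting.transportCocycle c h f))
    congr 1
    apply Subtype.ext; funext y; apply Subtype.ext
    rw [ContH1.conjCocycle_apply]
    have hAB : (⟨γ'.toMulEquiv.symm (y : D.PiTemp), ThetaSetting.symm_mem_GtpYdd h' y⟩ : D.GtpYdd) =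
        ⟨γ.toMulEquiv.symm ((MulAut.conjNormal u⁻¹ y : D.GtpYdd) : D.PiTemp), ThetaSetting.symm_mem_GtpYdd h _⟩ := by
      apply Subtype.ext
      show γ'.symm (y : D.PiTemp) = γ.symm (((MulAut.conjNormal u⁻¹ y : D.GtpYdd) : D.PiTemp))
      rw [hinv]
      congr 1
      simp only [MulAut.conjNormal_apply, inv_inv]
    change (c'.thetaIso (f.1 ⟨γ'.toMulEquiv.symm (y : D.PiTemp), ThetaSetting.symm_mem_GtpYdd h' y⟩ : D.GtpTheta)) =
      D.toTheta u * (c.thetaIso (f.1 ⟨γ.toMulEquiv.symm ((MulAut.conjNormal u⁻¹ y : D.GtpYdd) : D.PiTemp),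
        ThetaSetting.symm_mem_GtpYdd h _⟩ : D.GtpTheta)) * (D.toTheta u)⁻¹
    rw [hθ, hAB]

variable (C)

/-- **G-w5d169-2, ROUTE 2, v2 — the `hE`-body with `Dtau`-stability UP TO AN INNER AUTOMORPHISM**: as
`extends_transport_eq_conj_of_cor28_i`, but asking only that every tower-stabilising `Γ ∈ Aut_top(Π^tp_C)` becomes
`Dtau`-stabilising after composing with an inner automorphism `γ_{ι u}`, `u ∈ Π^tp_{X̲̲}` (print: «`γ` maps `τ` to `τ^{±1}`»,
proof of Thm 1.10). [cite: MochizukiEtTh2009, Cor 2.8(i) p.42] -/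
theorem extends_transport_eq_conj_of_cor28_i_innerAdjust [(PiYdd C).Normal] [D.GtpYdd.Normal]
    (hιe : IsOpenEmbedding ε.ι)
    (hιX : ε.ι.range = T.tp T.PiX) (hq : IsQuotientMap D.toTheta) (hC : D.Compat) (hS : D.Sec2Hyps)
    (hΔ : ∀ γ : D.PiTemp ≃ₜ* D.PiTemp, D.DeltaTemp.map γ.toMulEquiv.toMonoidHom = D.DeltaTemp)
    (h24 : T.Prop24) (hstd : (ThetaOrbitData.ofEmbedding ε hC hS).IsStandard)
    (h28 : (ThetaOrbitData.ofEmbedding ε hC hS).Cor28_i)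
    (hDtau : ∀ Γ : T.Gtp ≃ₜ* T.Gtp, (∀ S ∈ T.tower, S.map Γ.toMulEquiv.toMonoidHom = S) →
      ∃ u ∈ C.Huu, ∀ Dt ∈ (ThetaOrbitData.ofEmbedding ε hC hS).Dtau,
        Dt.map (Γ.trans (ThetaOrbitData.innerAutTop (ε.ι u))).toMulEquiv.toMonoidHom ∈
          (ThetaOrbitData.ofEmbedding ε hC hS).Dtau)
    (α : (Pi C) ≃ₜ* (Pi C)) :
    ∃ (γ : D.PiTemp ≃ₜ* D.PiTemp) (_ : ∀ x : Pi C, ((α x : Pi C) : D.PiTemp) = γ (x : D.PiTemp))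
      (h : ThetaSetting.Thm16i γ) (c : ThetaSetting.ThetaCompanion γ) (τ : Pi C),
      ContH1.comap D.toTheta D.DeltaTheta C.Huu.subtype continuous_subtype_val
          (map_subtype_piYdd_inf_le_GtpYdd C ⊤) (ThetaSetting.transport c h E.etaDd) =
        ContH1.comap D.toTheta D.DeltaTheta C.Huu.subtype continuous_subtype_val
          (map_subtype_piYdd_inf_le_GtpYdd C ⊤) (ContH1.conj D.toTheta D.DeltaTheta (τ : D.PiTemp) E.etaDd) := by
  obtain ⟨Γ, γ, hΓtower, hγ, hext⟩ := exists_extension_of_prop24 C ε hιe hιX h24 α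
  have hY : T.PiYddtp.map Γ.toMulEquiv.toMonoidHom = T.PiYddtp := hΓtower _ (by simp [TemperedCoverData.tower])
  have h16 : ThetaSetting.Thm16i γ := thm16i_of_restrict C ε hγ hY
  let c : ThetaSetting.ThetaCompanion γ := D.thetaCompanionOfAut γ (hΔ γ) hq
  -- the inner adjustment
  obtain ⟨u, hu, hDtau'⟩ := hDtau Γ hΓtower
  let Γ' : T.Gtp ≃ₜ* T.Gtp := Γ.trans (ThetaOrbitData.innerAutTop (ε.ι u))
  let κu : D.PiTemp ≃ₜ* D.PiTemp :=
    { MulAut.conj u with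
      continuous_toFun := by
        show Continuous fun z : D.PiTemp => u * z * u⁻¹
        exact (continuous_const.mul continuous_id).mul continuous_const
      continuous_invFun := by
        show Continuous fun z : D.PiTemp => u⁻¹ * z * u
        exact (continuous_const.mul continuous_id).mul continuous_const }
  let γ' : D.PiTemp ≃ₜ* D.PiTemp := γ.trans κu
  have hγ'def : ∀ z, γ' z = u * γ z * u⁻¹ := fun z => rfl
  have hΓ'tower : ∀ S ∈ T.tower, S.map Γ'.toMulEquiv.toMonoidHom = S := fun S hS =>
    ThetaOrbitData.map_trans_eq S (hΓtower S hS) (map_innerAutTop_tower_of_mem_Huu ε hu S hS)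
  have hγ' : ∀ g, ε.ι (γ' g) = Γ' (ε.ι g) := fun g => by
    show ε.ι (u * γ g * u⁻¹) = ε.ι u * Γ (ε.ι g) * (ε.ι u)⁻¹
    rw [map_mul, map_mul, map_inv, hγ]
  have hY' : T.PiYddtp.map Γ'.toMulEquiv.toMonoidHom = T.PiYddtp := hΓ'tower _ (by simp [TemperedCoverData.tower])
  have h16' : ThetaSetting.Thm16i γ' := thm16i_of_restrict C ε hγ' hY'
  let c' : ThetaSetting.ThetaCompanion γ' := D.thetaCompanionOfAut γ' (hΔ γ') hq
  obtain ⟨σ₁, hσ₁, f₀, f₁, d₀, hf₀, hf₁, hrel⟩ :=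
    ε.exists_rep_transport_eq_mul_coboundary_of_cor28_i hC hS hγ' h16' c' hΓ'tower hDtau' hstd h28
  refine ⟨γ, hext, h16, c, (⟨u, hu⟩ : Pi C)⁻¹ * ⟨σ₁, hσ₁⟩, ?_⟩
  -- v1's computation for `(Γ', γ', c')`: comap (transport c' h16' η̈) = comap (conj σ₁ η̈)
  have hv1 : ContH1.comap D.toTheta D.DeltaTheta C.Huu.subtype continuous_subtype_val
        (map_subtype_piYdd_inf_le_GtpYdd C ⊤) (ThetaSetting.transport c' h16' E.etaDd) =
      ContH1.comap D.toTheta D.DeltaTheta C.Huu.subtype continuous_subtype_val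
        (map_subtype_piYdd_inf_le_GtpYdd C ⊤)
        (ContH1.conj D.toTheta D.DeltaTheta ((⟨σ₁, hσ₁⟩ : Pi C) : D.PiTemp) E.etaDd) := by
    rw [show ContH1.conj D.toTheta D.DeltaTheta ((⟨σ₁, hσ₁⟩ : Pi C) : D.PiTemp) E.etaDd = ContH1.mk f₁.1 f₁.2
      from hf₁.symm]
    conv_lhs => rw [← hf₀]
    change QuotientGroup.mk (ContH1.comapCocycle D.toTheta D.DeltaTheta C.Huu.subtype continuous_subtype_val
        (map_subtype_piYdd_inf_le_GtpYdd C ⊤) (ThetaSetting.transportCocycle c' h16' f₀)) =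
      QuotientGroup.mk (ContH1.comapCocycle D.toTheta D.DeltaTheta C.Huu.subtype continuous_subtype_val
        (map_subtype_piYdd_inf_le_GtpYdd C ⊤) f₁)
    rw [QuotientGroup.eq]
    refine Subgroup.mem_subgroupOf.mpr ((mem_contCoboundaries_iff _).mpr ⟨d₀⁻¹, ?_⟩)
    funext y
    have hyH : ((y : Pi C) : D.PiTemp) ∈ C.Huu := (y : Pi C).2
    have hyY : ((y : Pi C) : D.PiTemp) ∈ D.GtpYdd :=
      map_subtype_piYdd_inf_le_GtpYdd C ⊤ ⟨y, y.2, rfl⟩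
    have key := hrel ⟨((y : Pi C) : D.PiTemp), hyY⟩ hyH
    show ((ThetaSetting.transportCocycle c' h16' f₀).1 ⟨((y : Pi C) : D.PiTemp), hyY⟩)⁻¹ *
        f₁.1 ⟨((y : Pi C) : D.PiTemp), hyY⟩ =
      MulAut.conjNormal (D.toTheta ((y : Pi C) : D.PiTemp)) d₀⁻¹ * d₀⁻¹⁻¹
    rw [key, mul_inv_rev, inv_mul_cancel_right, mul_inv_rev, inv_inv, map_inv]
    exact IsMulCommutative.is_comm.comm _ _
  -- transport along `γ' = conj_u ∘ γ` is `conj_u ∘ transport along γ`; pull back and cancel `conj_u`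
  rw [transport_of_inner_trans u hγ'def h16 h16' c c'] at hv1
  have hcu := ContH1.comap_conj D.toTheta D.DeltaTheta C.Huu.subtype continuous_subtype_val
    (map_subtype_piYdd_inf_le_GtpYdd C ⊤) (⟨u, hu⟩ : Pi C) (ThetaSetting.transport c h16 E.etaDd)
  have hcσ := ContH1.comap_conj D.toTheta D.DeltaTheta C.Huu.subtype continuous_subtype_val
    (map_subtype_piYdd_inf_le_GtpYdd C ⊤) (⟨σ₁, hσ₁⟩ : Pi C) E.etaDd
  have hcτ := ContH1.comap_conj D.toTheta D.DeltaTheta C.Huu.subtype continuous_subtype_val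
    (map_subtype_piYdd_inf_le_GtpYdd C ⊤) ((⟨u, hu⟩ : Pi C)⁻¹ * ⟨σ₁, hσ₁⟩) E.etaDd
  change ContH1.comap D.toTheta D.DeltaTheta C.Huu.subtype continuous_subtype_val
      (map_subtype_piYdd_inf_le_GtpYdd C ⊤)
      (ContH1.conj D.toTheta D.DeltaTheta (C.Huu.subtype ⟨u, hu⟩) (ThetaSetting.transport c h16 E.etaDd)) =
    ContH1.comap D.toTheta D.DeltaTheta C.Huu.subtype continuous_subtype_val
      (map_subtype_piYdd_inf_le_GtpYdd C ⊤)
      (ContH1.conj D.toTheta D.DeltaTheta (C.Huu.subtype ⟨σ₁, hσ₁⟩) E.etaDd) at hv1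
  rw [hcu, hcσ] at hv1
  change _ = ContH1.comap D.toTheta D.DeltaTheta C.Huu.subtype continuous_subtype_val
      (map_subtype_piYdd_inf_le_GtpYdd C ⊤)
      (ContH1.conj D.toTheta D.DeltaTheta (C.Huu.subtype ((⟨u, hu⟩ : Pi C)⁻¹ * ⟨σ₁, hσ₁⟩)) E.etaDd)
  rw [hcτ, ContH1.conj_mul_apply, ← hv1, ContH1.conj_inv_conj_apply]

end InnerAdjust

section RootInnerAdjust

variable [(PiYdd C).Normal] [D.GtpYdd.Normal] (hq : IsQuotientMap D.toTheta) {N : ℕ+} (μ : D.CyclotomeMod l N)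
  (hC : D.Compat) (hS : D.Sec2Hyps) (h15 : D.Prop15iii E hC) (L : C.CuspLabels) (R : RigidData.{0} N l)
  (hR : R = C.rigidData μ hC hS h15 L) (h218i : R.Cor218_i)

/-- **G-w5d169-2 ALONG ROUTE 2, v2**: `hroot` from F-0609, F-0640 at `ofEmbedding` (standard type), `γ(Δ^tp_X) = Δ^tp_X`, an
open orbit embedding onto `Π^tp_X` of `T`, and `Dtau`-stability of the Prop 2.4 extensions UP TO INNER AUTOMORPHISMS from
`Π^tp_{X̲̲}` (the v1 form `rootHyp_of_cor28_i` asked exact stability of every tower-stabilising `Γ`, FINDING F-w5d118g5-1).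
[cite: MochizukiEtTh2009, Cor 2.8(i) p.42] -/
theorem rootHyp_of_cor28_i_innerAdjust (hιe : IsOpenEmbedding ε.ι) (hιX : ε.ι.range = T.tp T.PiX)
    (hΔ : ∀ γ : D.PiTemp ≃ₜ* D.PiTemp, D.DeltaTemp.map γ.toMulEquiv.toMonoidHom = D.DeltaTemp)
    (h24 : T.Prop24) (hstd : (ThetaOrbitData.ofEmbedding ε hC hS).IsStandard)
    (h28 : (ThetaOrbitData.ofEmbedding ε hC hS).Cor28_i)
    (hDtau : ∀ Γ : T.Gtp ≃ₜ* T.Gtp, (∀ S ∈ T.tower, S.map Γ.toMulEquiv.toMonoidHom = S) →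
      ∃ u ∈ C.Huu, ∀ Dt ∈ (ThetaOrbitData.ofEmbedding ε hC hS).Dtau,
        Dt.map (Γ.trans (ThetaOrbitData.innerAutTop (ε.ι u))).toMulEquiv.toMonoidHom ∈
          (ThetaOrbitData.ofEmbedding ε hC hS).Dtau)
    (α : (Pi C) ≃ₜ* (Pi C)) :
    ∃ τ : Pi C, ∃ e : (coh C).H1 ⊤, l • e = 0 ∧
      autActTopOfCor218i C hq μ hC hS h15 L R hR h218i α (rootTop C) =
        h1TopConjEquiv (phi C) (D.lDeltaTheta l) (PiYdd C) τ (rootTop C) + e :=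
  rootHyp_of_forall_extends_transport C hq μ hC hS h15 L R hR h218i
    (fun α' => extends_transport_eq_conj_of_cor28_i_innerAdjust C ε hιe hιX hq hC hS hΔ h24 hstd h28 hDtau α') α

end RootInnerAdjust

end EtaleThetaDataOfSetting

end Literature.IUT.HodgeArakelov

end
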